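import Literature.Probability.RandomPlanarGeometry.SAWRenewalMeasureSLLN
import Literature.Probability.RandomPlanarGeometry.HammersleyWelshBound
import Literature.Probability.RandomPlanarGeometry.SAWSubBallistic
import Mathlib.Probability.Moments.SubGaussian
import HarnessLib

/-!
# Renewal times of a uniform bridge have exponentially small density (DCH 2013, Cor 2.4 argument; lane K3⁺)

Topic `Literature/Probability/RandomPlanarGeometry` (continues `SAWRenewalMeasureSLLN.lean` — i.i.d. block
statistics of Kesten's renewal measure `Q^B`, the (8.3.13) counting transfer `card_filter_div_pow_le_measureReal`,
`breakCyl`; `SAWKestenRenewalMeasure.lean` — unique decomposition of a bridge into irreducible pieces;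
`HammersleyWelshBound.lean` — `e^{-c√n} μ^n ≤ b_n`; `SAWSubBallistic.lean` — the named fact
`DuminilCopinHammond2013_thm2_5`, a theorem of the tree as of the lane's «DCH-2.5» chain).

Source: H. Duminil-Copin, A. Hammond, *Self-avoiding walk is sub-ballistic*, CMP 324 (2013): the proof of
Corollary 2.4 (arXiv:1205.0401, §3, p. 11) — "if `E_{iSAB}|γ| = ∞` then renewal points have zero density": truncate
the i.i.d. block lengths of the bi-infinite bridge measure, apply an exponential Markov (Chernoff/Hoeffding)
inequality, and transfer to the uniform measure on `SAB_n` losing only the Hammersley–Welsh factor `e^{C√n}`.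
Here at fixed length `n` on Kesten's one-sided renewal measure `Q^B` (M–S Theorem 8.3.2), every `ℤ^{d+2}`.

## Contents (namespace `Literature.Probability.RandomPlanarGeometry.SAW.Zd`)
* `renewalCount n ω` (a-idea-2's typed object, lane «DCH-1.1» node K3⁺, `Sketch_v8_DCH11.lean` 52782ed6…, body
  verbatim) and `renewalCount_piecesWalk : R(φ^[1] ∘ ⋯ ∘ φ^[j]) = j + 1`;
* `card_manyRenewals_div_pow_le` — `#{β ∈ B_n : R(β) ≥ m+1} μ^{-n} ≤ Q^B{|η^[1]| + ⋯ + |η^[m]| ≤ n}` ((8.3.13));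
* `IrrPiece.lenTrunc`, `integral_lenTrunc_eq_tsum`, `sum_range_le_integral_lenTrunc`,
  `tendsto_integral_lenTrunc_atTop` — under Theorem 2.5 the truncated block-length means are unbounded;
* `measureReal_partialLen_le_exp` — Hoeffding (Mathlib `hasSubgaussianMGF_of_mem_Icc_of_integral_eq_zero`,
  `HasSubgaussianMGF.measure_sum_range_ge_le_of_iIndepFun`): `Q^B{S_m ≤ A m} ≤ e^{-m/(2(K/2)²)}` once
  `E[min(|η|,K)] ≥ A + 1`;
* **`card_manyRenewals_le_exp`** (`ℤ^{d+2}` form) and **`renewalDensityExpSmall_of_thm25`** (every `d ≥ 2`; the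
  body of a-idea-2's node `RenewalDensityExpSmall`, whose named `Prop` + discharge land with the importer of
  `DuminilCopinHammond2013_thm2_5_holds`).

Printed status: a step (Cor 2.4's mechanism) of a PRINTED proof, formalised at fixed length; no novelty claimed.
[cite: DuminilCopinHammond2013, Corollary 2.4 (proof) and Theorem 2.5]
-/

noncomputable section

open Finset MeasureTheory ProbabilityTheory Filter Topology Literature.Probability.LatticeModels
  Literature.Probability.Percolation
open scoped BigOperators ENNReal

namespace Literature.Probability.RandomPlanarGeometry.SAW.Zd

variable {d : ℕ} [NeZero d]

section K3

/-! ### The number of renewal times -/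

open Classical in
/-- Number of renewal times (break points) `i ∈ [0, n]` of the `n`-step walk `ω` (body = a-idea-2's typed
object, `Sketch_v8_DCH11.lean`). [cite: DuminilCopinHammond2013, §2.2 and Cor 2.4] -/
def renewalCount {d : ℕ} [NeZero d] (n : ℕ) (ω : ℕ → Site d) : ℕ :=
  ((Finset.range (n + 1)).filter fun i => IsRenewalTime n ω i).card

/-- Partial concatenations grow strictly: `piecesLen (l.take k) < piecesLen (l.take k')` for `k < k' ≤ |l|`.
[cite: MadrasSlade1993, §8.3, p. 275 (2013 reprint)] -/
theorem piecesLen_take_lt_of_lt (l : List (IrrPiece d)) {k k' : ℕ} (hkk' : k < k') (hk' : k' ≤ l.length) :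
    piecesLen (l.take k) < piecesLen (l.take k') := by
  have hsplit : l.take k' = l.take k ++ (l.drop k).take (k' - k) := by
    rw [← List.take_add, Nat.add_sub_cancel' hkk'.le]
  rw [hsplit, piecesLen_append]
  have hne : (l.drop k).take (k' - k) ≠ [] := by
    apply List.ne_nil_of_length_pos
    rw [List.length_take, List.length_drop]
    omega
  have := piecesLen_pos_of_ne_nil hne
  omega

/-- **A concatenation of `j` irreducible pieces has exactly `j + 1` renewal times** (the partial sums,
including `0` and the total length). [cite: DuminilCopinHammond2013, §2.2; MadrasSlade1993, §8.3] -/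
theorem renewalCount_piecesWalk (l : List (IrrPiece d)) :
    renewalCount (piecesLen l) (piecesWalk l) = l.length + 1 := by
  classical
  unfold renewalCount
  have hset : ((Finset.range (piecesLen l + 1)).filter fun i => IsRenewalTime (piecesLen l) (piecesWalk l) i) =
      (Finset.range (l.length + 1)).image fun k => piecesLen (l.take k) := by
    ext i
    simp only [Finset.mem_filter, Finset.mem_range, Finset.mem_image, Nat.lt_succ_iff]
    constructor
    · rintro ⟨-, hren⟩
      obtain ⟨l₁, l₂, hl, hl₁⟩ := exists_split_of_isRenewalTime l hren
      refine ⟨l₁.length, by rw [hl, List.length_append]; omega, ?_⟩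
      rw [hl, List.take_left', hl₁]
      rfl
    · rintro ⟨k, hk, rfl⟩
      refine ⟨?_, ?_⟩
      · have := piecesLen_append (l.take k) (l.drop k)
        rw [List.take_append_drop] at this
        omega
      · have h := isRenewalTime_piecesWalk_append (l.take k) (l.drop k)
        rwa [List.take_append_drop] at h
  rw [hset, Finset.card_image_of_injOn, Finset.card_range]
  intro k hk k' hk' hkk'
  simp only [Finset.coe_range, Set.mem_Iio, Nat.lt_succ_iff] at hk hk'
  by_contra hne
  rcases lt_or_gt_of_ne hne with hlt | hlt
  · exact absurd hkk' (ne_of_lt (piecesLen_take_lt_of_lt l hlt hk'))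
  · exact absurd hkk' (ne_of_gt (piecesLen_take_lt_of_lt l hlt hk))

/-! ### Transfer: many renewal times ⇒ the first `m` pieces are short in total -/

section K3transfer

variable {d' : ℕ}

/-- **If an `n`-step bridge has `≥ m + 1` renewal times, the first `m` pieces of every sequence in its
break-point cylinder have total length `≤ n`**; hence, by (8.3.13),
`#{β ∈ B_n : m + 1 ≤ R(β)} · μ^{-n} ≤ Q^B{|η^[1]| + ⋯ + |η^[m]| ≤ n}`.
[cite: DuminilCopinHammond2013, proof of Corollary 2.4; MadrasSlade1993, §8.3, eq. (8.3.13)] -/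
theorem card_manyRenewals_div_pow_le (n m : ℕ) :
    (#((bridges (d' + 2) n).filter fun β => m + 1 ≤ renewalCount n β) : ℝ) / connectiveConstant (d' + 2) ^ n ≤
      (renewalBridgeMeasure (d' + 2) {φ | piecesLen (takePieces φ m) ≤ n}).toReal := by
  classical
  refine card_filter_div_pow_le_measureReal _ fun β hβ hR φ hφ => ?_
  obtain ⟨l, hl, rfl⟩ := exists_pieces_of_mem_bridges n hβ
  subst hl
  rw [renewalCount_piecesWalk] at hR
  have hml : m ≤ l.length := by omega
  have hbox : φ ∈ pieceBox l := by
    rw [← breakPointCylinder_eq_pieceBox (rfl : piecesLen l = piecesLen l)]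
    exact hφ
  have hφ' : takePieces φ l.length = l := hbox
  show piecesLen (takePieces φ m) ≤ piecesLen l
  have hsplit := takePieces_add φ m (l.length - m)
  rw [Nat.add_sub_cancel' hml, hφ'] at hsplit
  rw [hsplit, piecesLen_append]
  omega

end K3transfer

/-! ### Truncated block lengths: under Theorem 2.5 their means are unbounded -/

/-- The block length truncated at level `K`. [cite: DuminilCopinHammond2013, proof of Corollary 2.4] -/
def IrrPiece.lenTrunc (K : ℕ) (x : IrrPiece d) : ℝ := min (x.len : ℝ) K

/-- `0 ≤ min(|φ|, K) ≤ K`. [cite: DuminilCopinHammond2013, proof of Corollary 2.4] -/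
theorem IrrPiece.lenTrunc_mem_Icc (K : ℕ) (x : IrrPiece d) : x.lenTrunc K ∈ Set.Icc (0 : ℝ) K :=
  ⟨le_min (Nat.cast_nonneg _) (Nat.cast_nonneg _), min_le_right _ _⟩

/-- `min(|φ|, K) ≤ |φ|`. [cite: DuminilCopinHammond2013, proof of Corollary 2.4] -/
theorem IrrPiece.lenTrunc_le_len (K : ℕ) (x : IrrPiece d) : x.lenTrunc K ≤ x.len := min_le_left _ _

/-- The truncated length is integrable (bounded). [cite: DuminilCopinHammond2013, proof of Corollary 2.4] -/
theorem integrable_lenTrunc (K : ℕ) : Integrable (IrrPiece.lenTrunc (d := d) K) (irrPieceLaw d) :=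
  Integrable.of_mem_Icc 0 (K : ℝ) (measurable_pieceStat _).aemeasurable
    (ae_of_all _ fun x => IrrPiece.lenTrunc_mem_Icc K x)

/-- The `k`-series `Σ_k λ_k μ^{-k} min(k, K)` is summable (dominated by `K Σ_k λ_k μ^{-k} = K`).
[cite: DuminilCopinHammond2013, proof of Corollary 2.4; MadrasSlade1993, eq. (4.2.4)] -/
theorem summable_irr_div_pow_mul_min (K : ℕ) :
    Summable fun k : ℕ => (irreducibleBridgeCount d k : ℝ) / connectiveConstant d ^ k * min (k : ℝ) K := by
  have hμ := connectiveConstant_pos d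
  refine ((MadrasSlade1993_eq424_holds d).summable.mul_left (K : ℝ)).of_nonneg_of_le
    (fun k => by positivity) fun k => ?_
  have h1 : min (k : ℝ) K ≤ K := min_le_right _ _
  have h0 : 0 ≤ (irreducibleBridgeCount d k : ℝ) / connectiveConstant d ^ k := by positivity
  nlinarith

/-- **The truncated mean as a series over lengths**: `E[min(|φ|, K)] = Σ_k λ_k μ^{-k} min(k, K)`.
[cite: DuminilCopinHammond2013, proof of Corollary 2.4] -/
theorem integral_lenTrunc_eq_tsum (K : ℕ) :
    ∫ x, IrrPiece.lenTrunc K x ∂(irrPieceLaw d) =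
      ∑' k : ℕ, (irreducibleBridgeCount d k : ℝ) / connectiveConstant d ^ k * min (k : ℝ) K := by
  have hμ := connectiveConstant_pos d
  have hsum2 : Summable fun x : IrrPiece d => (connectiveConstant d ^ x.len)⁻¹ * x.lenTrunc K :=
    summable_weight_mul_of_len (d := d) (f := fun k => min (k : ℝ) K) (fun k => by positivity)
      (summable_irr_div_pow_mul_min K)
  rw [integral_irrPieceLaw_eq_tsum (integrable_lenTrunc K), ← (IrrPiece.equivSigma d).symm.tsum_eq]
  have hcomp : ((fun x : IrrPiece d => (connectiveConstant d ^ x.len)⁻¹ * x.lenTrunc K) ∘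
      (IrrPiece.equivSigma d).symm) =
      fun p : (Σ k : ℕ, {η : ℕ → Site d // η ∈ irreducibleBridges d k}) =>
        (connectiveConstant d ^ p.1)⁻¹ * min (p.1 : ℝ) K := by
    funext p; rfl
  have hsumS : Summable (fun p : (Σ k : ℕ, {η : ℕ → Site d // η ∈ irreducibleBridges d k}) =>
      (connectiveConstant d ^ p.1)⁻¹ * min (p.1 : ℝ) K) := by
    rw [← hcomp]; exact (IrrPiece.equivSigma d).symm.summable_iff.2 hsum2
  rw [show (fun c => ((fun x : IrrPiece d => (connectiveConstant d ^ x.len)⁻¹ * x.lenTrunc K))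
      ((IrrPiece.equivSigma d).symm c)) = fun p : (Σ k : ℕ, {η : ℕ → Site d // η ∈ irreducibleBridges d k}) =>
        (connectiveConstant d ^ p.1)⁻¹ * min (p.1 : ℝ) K from hcomp]
  rw [Summable.tsum_sigma' (fun k => (hasSum_fintype _).summable) hsumS]
  refine tsum_congr fun k => ?_
  rw [tsum_fintype]
  dsimp only
  rw [Finset.sum_const, Finset.card_univ, Fintype.card_coe, nsmul_eq_mul, div_eq_mul_inv]
  rw [irreducibleBridgeCount]
  ring

/-- A lower bound for the truncated mean by a partial sum of Kesten's mean series: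
`Σ_{k ≤ K} k λ_k μ^{-k} ≤ E[min(|φ|, K)]`. [cite: DuminilCopinHammond2013, proof of Corollary 2.4] -/
theorem sum_range_le_integral_lenTrunc (K : ℕ) :
    ∑ k ∈ Finset.range (K + 1), (k : ℝ) * ((irreducibleBridgeCount d k : ℝ) / connectiveConstant d ^ k) ≤
      ∫ x, IrrPiece.lenTrunc K x ∂(irrPieceLaw d) := by
  have hμ := connectiveConstant_pos d
  rw [integral_lenTrunc_eq_tsum]
  calc ∑ k ∈ Finset.range (K + 1), (k : ℝ) * ((irreducibleBridgeCount d k : ℝ) / connectiveConstant d ^ k)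
      = ∑ k ∈ Finset.range (K + 1), (irreducibleBridgeCount d k : ℝ) / connectiveConstant d ^ k * min (k : ℝ) K := by
        refine Finset.sum_congr rfl fun k hk => ?_
        have hkK : (k : ℝ) ≤ K := by exact_mod_cast (by have := Finset.mem_range.1 hk; omega : k ≤ K)
        rw [min_eq_left hkK]; ring
    _ ≤ ∑' k : ℕ, (irreducibleBridgeCount d k : ℝ) / connectiveConstant d ^ k * min (k : ℝ) K :=
        (summable_irr_div_pow_mul_min K).sum_le_tsum _ fun k _ => by positivity

/-- **Under Theorem 2.5 the truncated means are unbounded**: `E[min(|φ|, K)] → ∞` as `K → ∞`.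
[cite: DuminilCopinHammond2013, Theorem 2.5 and proof of Corollary 2.4] -/
theorem tendsto_integral_lenTrunc_atTop
    (h25 : ¬ Summable fun k : ℕ => (k : ℝ) * ((irreducibleBridgeCount d k : ℝ) / connectiveConstant d ^ k)) :
    Tendsto (fun K : ℕ => ∫ x, IrrPiece.lenTrunc K x ∂(irrPieceLaw d)) atTop atTop := by
  have hμ := connectiveConstant_pos d
  have hpart : Tendsto (fun K : ℕ => ∑ k ∈ Finset.range K,
      (k : ℝ) * ((irreducibleBridgeCount d k : ℝ) / connectiveConstant d ^ k)) atTop atTop :=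
    (not_summable_iff_tendsto_nat_atTop_of_nonneg (fun k => by positivity)).1 h25
  refine tendsto_atTop_mono (fun K => ?_) (hpart.comp (tendsto_add_atTop_nat 1))
  exact sum_range_le_integral_lenTrunc K

/-! ### Exponential lower tail for the partial sums of block lengths (Hoeffding on truncated blocks) -/

/-- **Cramér-type lower tail**: if `E[min(|η|, K)] ≥ A + 1`, then
`Q^B{|η^[1]| + ⋯ + |η^[m]| ≤ A m} ≤ exp(-m / (2 (K/2)²))` for every `m` — Hoeffding's inequality
(Mathlib `hasSubgaussianMGF_of_mem_Icc_of_integral_eq_zero`, `measure_sum_range_ge_le_of_iIndepFun`) for the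
independent bounded variables `E[min(|η|,K)] - min(|η^[i]|, K)`.
[cite: DuminilCopinHammond2013, proof of Corollary 2.4] -/
theorem measureReal_partialLen_le_exp {A : ℝ} {K : ℕ}
    (hK : A + 1 ≤ ∫ x, IrrPiece.lenTrunc K x ∂(irrPieceLaw d)) (m : ℕ) :
    (renewalBridgeMeasure d).real {φ | (piecesLen (takePieces φ m) : ℝ) ≤ A * m} ≤
      Real.exp (-(m : ℝ) / (2 * ((K : ℝ) / 2) ^ 2)) := by
  set EY : ℝ := ∫ x, IrrPiece.lenTrunc K x ∂(irrPieceLaw d) with hEY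
  set X : ℕ → (ℕ → IrrPiece d) → ℝ := fun i φ => EY - (φ i).lenTrunc K with hX
  have hindep : iIndepFun X (renewalBridgeMeasure d) :=
    iIndepFun_pieceStat (g := fun x => EY - x.lenTrunc K)
  set c : NNReal := (‖EY - (EY - K)‖₊ / 2) ^ 2 with hc
  have hsubG : ∀ i, HasSubgaussianMGF (X i) c (renewalBridgeMeasure d) := by
    intro i
    have hmeasX : Measurable (X i) :=
      (measurable_pieceStat (fun x : IrrPiece d => EY - x.lenTrunc K)).comp (measurable_pi_apply i)
    refine hasSubgaussianMGF_of_mem_Icc_of_integral_eq_zero hmeasX.aemeasurable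
      (ae_of_all _ fun φ => ?_) ?_
    · have h1 := (IrrPiece.lenTrunc_mem_Icc K (φ i)).1
      have h2 := (IrrPiece.lenTrunc_mem_Icc K (φ i)).2
      simp only [hX, Set.mem_Icc]
      constructor <;> linarith
    · show ∫ φ, EY - (φ i).lenTrunc K ∂(renewalBridgeMeasure d) = 0
      rw [integral_sub (integrable_const _) (integrable_pieceStat (integrable_lenTrunc K) i), integral_const,
        smul_eq_mul, probReal_univ, one_mul, integral_pieceStat (IrrPiece.lenTrunc K) i, sub_self]
  have hHoeff := HasSubgaussianMGF.measure_sum_range_ge_le_of_iIndepFun hindep (c := c) (n := m)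
    (fun i _ => hsubG i) (Nat.cast_nonneg m)
  have hsub : {φ : ℕ → IrrPiece d | (piecesLen (takePieces φ m) : ℝ) ≤ A * m} ⊆
      {φ | (m : ℝ) ≤ ∑ i ∈ Finset.range m, X i φ} := by
    intro φ hφ
    simp only [Set.mem_setOf_eq] at hφ ⊢
    have h1 : ∑ i ∈ Finset.range m, X i φ = m * EY - ∑ i ∈ Finset.range m, (φ i).lenTrunc K := by
      simp only [hX, Finset.sum_sub_distrib, Finset.sum_const, Finset.card_range, nsmul_eq_mul]
    have h2 : ∑ i ∈ Finset.range m, (φ i).lenTrunc K ≤ ∑ i ∈ Finset.range m, ((φ i).len : ℝ) :=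
      Finset.sum_le_sum fun i _ => IrrPiece.lenTrunc_le_len K (φ i)
    have h3 : (∑ i ∈ Finset.range m, ((φ i).len : ℝ)) = (piecesLen (takePieces φ m) : ℝ) := by
      rw [piecesLen_takePieces]; push_cast; rfl
    have hm : (0 : ℝ) ≤ m := Nat.cast_nonneg m
    nlinarith
  have hcval : (c : ℝ) = ((K : ℝ) / 2) ^ 2 := by
    simp only [hc, sub_sub_cancel, NNReal.coe_pow, NNReal.coe_div, coe_nnnorm, Real.norm_eq_abs, NNReal.coe_ofNat,
      Nat.abs_cast]
  calc (renewalBridgeMeasure d).real {φ | (piecesLen (takePieces φ m) : ℝ) ≤ A * m}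
      ≤ (renewalBridgeMeasure d).real {φ | (m : ℝ) ≤ ∑ i ∈ Finset.range m, X i φ} := measureReal_mono hsub
    _ ≤ Real.exp (-(m : ℝ) ^ 2 / (2 * m * c)) := hHoeff
    _ ≤ Real.exp (-(m : ℝ) / (2 * ((K : ℝ) / 2) ^ 2)) := by
        rw [hcval]
        rcases Nat.eq_zero_or_pos m with rfl | hm
        · simp
        · apply le_of_eq
          congr 1
          have hm' : (m : ℝ) ≠ 0 := by exact_mod_cast hm.ne'
          field_simp

/-! ### K3⁺: renewal times have exponentially small density -/

section K3final

variable {d' : ℕ}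

/-- The finite-mean alternative in `ℤ^{d'+2}` from the named fact (shape conversion). [cite: DuminilCopinHammond2013, Theorem 2.5] -/
theorem not_summable_mean_of_thm25 (h25 : DuminilCopinHammond2013_thm2_5) :
    ¬ Summable fun k : ℕ => (k : ℝ) *
      ((irreducibleBridgeCount (d' + 2) k : ℝ) / connectiveConstant (d' + 2) ^ k) := by
  intro hs
  refine h25 (d' + 2) (by omega) (hs.congr fun k => ?_)
  rw [inv_pow, div_eq_mul_inv, mul_assoc]

/-- **K3⁺ in `ℤ^{d'+2}` under Theorem 2.5**: for every `δ > 0` there is `ε > 0` with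
`#{β ∈ B_n : R(β) ≥ δ n} ≤ e^{-ε n} b_n` for all large `n`.
[cite: DuminilCopinHammond2013, proof of Corollary 2.4 (arXiv v1, p. 18) and Theorem 2.5 (p. 8)] -/
theorem card_manyRenewals_le_exp (h25 : DuminilCopinHammond2013_thm2_5) {δ : ℝ} (hδ : 0 < δ) :
    ∃ ε : ℝ, 0 < ε ∧ ∀ᶠ n : ℕ in atTop,
      ((((bridges (d' + 2) n).filter fun ω => δ * (n : ℝ) ≤ (renewalCount n ω : ℝ)).card : ℝ)
        ≤ Real.exp (-(ε * (n : ℝ))) * ((bridges (d' + 2) n).card : ℝ)) := by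
  classical
  have hμ := connectiveConstant_pos (d' + 2)
  set μ := connectiveConstant (d' + 2) with hμdef
  -- truncation level `K` with `E[min(|η|, K)] ≥ 2/δ + 1`
  set A : ℝ := 2 / δ with hA
  have hApos : 0 < A := by positivity
  obtain ⟨K, hK⟩ := (tendsto_atTop.1 (tendsto_integral_lenTrunc_atTop (not_summable_mean_of_thm25 h25))
    (A + 1)).exists
  have hK1 : 1 ≤ K := by
    by_contra h0
    have hK0 : K = 0 := by omega
    subst hK0
    have : ∫ x, IrrPiece.lenTrunc 0 x ∂(irrPieceLaw (d' + 2)) = 0 := by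
      have : (fun x : IrrPiece (d' + 2) => IrrPiece.lenTrunc 0 x) = fun _ => 0 := by
        funext x; simp [IrrPiece.lenTrunc]
      rw [this, integral_zero]
    linarith
  set c : ℝ := 2 * ((K : ℝ) / 2) ^ 2 with hcdef
  have hcpos : 0 < c := by positivity
  -- Hammersley–Welsh
  obtain ⟨C, hC⟩ := exp_mul_pow_le_bridgeCount (d := d' + 2)
  -- the rate
  refine ⟨δ / (4 * c), by positivity, ?_⟩
  have hev1 : ∀ᶠ n : ℕ in atTop, A ≤ (n : ℝ) := tendsto_natCast_atTop_atTop.eventually_ge_atTop A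
  have hev2 : ∀ᶠ n : ℕ in atTop, C * Real.sqrt n + 1 / c ≤ δ / (4 * c) * n := by
    -- `√n = o(n)`
    have h1 : Tendsto (fun n : ℕ => (C * Real.sqrt n + 1 / c) / n) atTop (𝓝 0) := by
      have hs : Tendsto (fun n : ℕ => Real.sqrt n / n) atTop (𝓝 0) := by
        have : Tendsto (fun n : ℕ => (Real.sqrt n)⁻¹) atTop (𝓝 0) :=
          tendsto_inv_atTop_zero.comp (Real.tendsto_sqrt_atTop.comp tendsto_natCast_atTop_atTop)
        refine this.congr fun n => ?_
        show (Real.sqrt n)⁻¹ = Real.sqrt n / n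
        rw [Real.sqrt_div_self]
      have hc0 : Tendsto (fun n : ℕ => (1 / c) / (n : ℝ)) atTop (𝓝 0) :=
        tendsto_const_nhds.div_atTop tendsto_natCast_atTop_atTop
      have := (hs.const_mul C).add hc0
      rw [mul_zero, zero_add] at this
      refine this.congr' ?_
      filter_upwards [eventually_gt_atTop 0] with n hn
      have hn' : (n : ℝ) ≠ 0 := by exact_mod_cast hn.ne'
      field_simp
    have h2 := (Metric.tendsto_nhds.1 h1) (δ / (4 * c)) (by positivity)
    filter_upwards [h2, eventually_gt_atTop 0] with n hn hn0
    rw [Real.dist_eq, sub_zero, abs_lt] at hn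
    have hnpos : (0 : ℝ) < n := by exact_mod_cast hn0
    have := hn.2
    rw [div_lt_iff₀ hnpos] at this
    exact this.le
  filter_upwards [hev1, hev2, eventually_gt_atTop 0] with n hnA hnrate hn0
  have hnpos : (0 : ℝ) < n := by exact_mod_cast hn0
  -- `m := ⌈δ n⌉₊ - 1`, so that `δ n ≤ R ↔ m + 1 ≤ R` for natural `R`
  set m : ℕ := ⌈δ * n⌉₊ - 1 with hmdef
  have hδn : 0 < δ * n := by positivity
  have hceil : 1 ≤ ⌈δ * (n : ℝ)⌉₊ := Nat.one_le_iff_ne_zero.2 (Nat.ceil_pos.2 hδn).ne'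
  have hfilter : ((bridges (d' + 2) n).filter fun ω => δ * (n : ℝ) ≤ (renewalCount n ω : ℝ)) =
      (bridges (d' + 2) n).filter fun ω => m + 1 ≤ renewalCount n ω := by
    refine Finset.filter_congr fun ω _ => ?_
    rw [hmdef, Nat.sub_add_cancel hceil]
    constructor
    · intro h; exact Nat.ceil_le.2 h
    · intro h; exact (Nat.le_ceil _).trans (by exact_mod_cast h)
  rw [hfilter]
  -- m ≥ δ n - 1 and A m ≥ n
  have hm_ge : δ * n - 1 ≤ (m : ℝ) := by
    have h1 : ((⌈δ * (n : ℝ)⌉₊ : ℕ) : ℝ) - 1 = (m : ℝ) := by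
      rw [hmdef]; push_cast [Nat.cast_sub hceil]; ring
    have h2 := Nat.le_ceil (δ * (n : ℝ))
    linarith
  have hAm : (n : ℝ) ≤ A * m := by
    rw [hA]
    have : 2 / δ * (δ * n - 1) ≤ 2 / δ * m := by gcongr
    have h2 : 2 / δ * (δ * n - 1) = 2 * n - 2 / δ := by field_simp
    rw [h2] at this
    have h3 : 2 / δ ≤ n := hnA
    linarith
  -- transfer + tail bound
  have hT := card_manyRenewals_div_pow_le (d' := d') n m
  have hP : (renewalBridgeMeasure (d' + 2) {φ | piecesLen (takePieces φ m) ≤ n}).toReal ≤ Real.exp (-(m : ℝ) / c) := by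
    have h1 : {φ : ℕ → IrrPiece (d' + 2) | piecesLen (takePieces φ m) ≤ n} ⊆
        {φ | (piecesLen (takePieces φ m) : ℝ) ≤ A * m} := fun φ hφ => by
      simp only [Set.mem_setOf_eq] at hφ ⊢
      exact le_trans (by exact_mod_cast hφ) hAm
    calc (renewalBridgeMeasure (d' + 2) {φ | piecesLen (takePieces φ m) ≤ n}).toReal
        ≤ (renewalBridgeMeasure (d' + 2)).real {φ | (piecesLen (takePieces φ m) : ℝ) ≤ A * m} :=
          measureReal_mono h1
      _ ≤ Real.exp (-(m : ℝ) / (2 * ((K : ℝ) / 2) ^ 2)) := measureReal_partialLen_le_exp hK m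
      _ = Real.exp (-(m : ℝ) / c) := by rw [hcdef]
  -- combine with Hammersley–Welsh
  have hb := hC n
  have hcard_le : ((((bridges (d' + 2) n).filter fun ω => m + 1 ≤ renewalCount n ω).card : ℝ)) ≤
      μ ^ n * Real.exp (-(m : ℝ) / c) := by
    have := hT.trans hP
    rwa [div_le_iff₀ (pow_pos hμ n), mul_comm] at this
  have hexp : μ ^ n * Real.exp (-(m : ℝ) / c) ≤ Real.exp (-(δ / (4 * c) * n)) * bridgeCount (d' + 2) n := by
    -- μ^n ≤ e^{C√n} b_n and -(m/c) + C√n ≤ -(δ/(4c)) n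
    have h1 : μ ^ n ≤ Real.exp (C * Real.sqrt n) * bridgeCount (d' + 2) n := by
      have := hb
      rw [Real.exp_neg, inv_mul_le_iff₀ (Real.exp_pos _)] at this
      linarith [this]
    have h2 : Real.exp (C * Real.sqrt n) * Real.exp (-(m : ℝ) / c) ≤ Real.exp (-(δ / (4 * c) * n)) := by
      rw [← Real.exp_add]
      apply Real.exp_le_exp.2
      have hm_c : (δ * n - 1) / c ≤ (m : ℝ) / c := div_le_div_of_nonneg_right hm_ge hcpos.le
      have : C * Real.sqrt n + -(m : ℝ) / c ≤ C * Real.sqrt n - (δ * n - 1) / c := by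
        rw [neg_div]; linarith
      refine this.trans ?_
      have h4 : (δ * n - 1) / c = δ / c * n - 1 / c := by field_simp
      rw [h4]
      have ht0 : 0 ≤ δ / (4 * c) * n := by positivity
      have h5 : δ / c * (n : ℝ) = 4 * (δ / (4 * c) * n) := by
        field_simp
      linarith [hnrate, ht0, h5]
    have hbn : (0 : ℝ) ≤ bridgeCount (d' + 2) n := Nat.cast_nonneg _
    calc μ ^ n * Real.exp (-(m : ℝ) / c)
        ≤ (Real.exp (C * Real.sqrt n) * bridgeCount (d' + 2) n) * Real.exp (-(m : ℝ) / c) :=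
          mul_le_mul_of_nonneg_right h1 (Real.exp_pos _).le
      _ = (Real.exp (C * Real.sqrt n) * Real.exp (-(m : ℝ) / c)) * bridgeCount (d' + 2) n := by ring
      _ ≤ Real.exp (-(δ / (4 * c) * n)) * bridgeCount (d' + 2) n := mul_le_mul_of_nonneg_right h2 hbn
  rw [bridgeCount] at hexp
  exact hcard_le.trans hexp

/-- **K3⁺ from Theorem 2.5, every `d ≥ 2`** — the body of a-idea-2's typed node `RenewalDensityExpSmall`
(`Sketch_v8_DCH11.lean`), stated inline (the named `Prop` and its discharge `_holds` follow in the file that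
imports the tree's `DuminilCopinHammond2013_thm2_5_holds`): for every `d ≥ 2` and `δ > 0` there is `ε > 0` with
`#{ω ∈ B_n : δ n ≤ R(ω)} ≤ e^{-ε n} #B_n` for all large `n`.
[cite: DuminilCopinHammond2013, Cor 2.4 proof (arXiv v1, p. 18) and Thm 2.5 (p. 8)] -/
theorem renewalDensityExpSmall_of_thm25 (h25 : DuminilCopinHammond2013_thm2_5) (d : ℕ) [NeZero d]
    (hd : 2 ≤ d) {δ : ℝ} (hδ : 0 < δ) :
    ∃ ε : ℝ, 0 < ε ∧ ∀ᶠ n : ℕ in atTop,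
      ((((bridges d n).filter fun ω => δ * (n : ℝ) ≤ (renewalCount n ω : ℝ)).card : ℝ)
        ≤ Real.exp (-(ε * (n : ℝ))) * ((bridges d n).card : ℝ)) := by
  obtain ⟨d', rfl⟩ : ∃ d', d = d' + 2 := ⟨d - 2, by omega⟩
  exact card_manyRenewals_le_exp h25 hδ

end K3final

end K3

end Literature.Probability.RandomPlanarGeometry.SAW.Zd

end
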